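import Summits.QuantumFields.YangMills.Theorems.BalabanUVNodesN19JacksonAbsolutePowers
import Literature.NumberTheory.Transcendental.BrownawellRedundantAuxiliary

/-!
# YM-DAG node N19 (= NE7 proper) — MULTISCALE TELESCOPING FOR OSCILLATING LINKS, PART 1: the multiplicative step and the ladder
# (`e^{i(φ₀ + ωΣ_l B_l)}` by a pair of real `MvPolynomial`s of total degree `Σ_l (n_l − 1)·deg B_l`, error `2Σ_l e^{ωR_l − n_l}`)

Cell `pub-ymgap`, HUMAN RULING D-0062 (Track A) ∕ D-0149 (work-bound push), R141 (C) wider-strategy seat `pub-ymgap-dag-n19-e` (strategy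
s3 = ALTERNATIVE CURRENCY), generation g30, module 1 (lineage module 118).  Route `Summits/QuantumFields/YangMills/Theses/BalabanUVNodes.lean`,
cluster item K3⁸ «SpineGivenEndpointR13SepCoPHV» (stmt-QuantumFields-27366); filed `--supports` that item `--as helper` (it proves no registered
stub).  COUNT-NEUTRAL: [folklore] approximation theory over Mathlib (`MvPolynomial.totalDegree`, `Complex.exp`) and, BY NAME,
`Literature…BrownawellRedundantAuxiliary` (`norm_cexp_sub_sum_le`: `‖e^s − Σ_{m<n} s^m∕m!‖ ≤ e^{W−n}` for `‖s‖ ≤ W`, `n ≥ e²W`); module 117 is imported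
for its Mathlib closure and for PART 2 (`…N19SingleModeL1Norm`, the single mode of the ℓ¹-norm); no laws, no scheme object, no Theses import; NOT a
discharge claim.

CONTEXT — THE OPEN ITEM (v′) OF CURRENCY-MAP v8 (HOME `numerics/OPEN-PROBLEM.md`, reformulation 3).  In the degree model of modules 107∕109∕112∕117,
`S_d(x) = Σ_{i≤d}|x_i|` on `[−1,1]^d`, the SINGLE-MODE LAW asks for `dist_∞(cos(ωS_d), Π_t) ≤ ψ(dω∕t)` uniformly in `d`.  Proved so far: `dω ≤ 1`
(power series in the `|x_i|`), `dω ≲ log t` (the |monomial| device, module 116: `(cosh(ωd) − 1)·C∕t`); nesting (module 111) gives `≍ ω²d²∕t`, the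
coordinate telescoping `∏_i e^{iω|x_i|}` gives `≍ ωd²∕t`; the numerics (k ≤ 8, t ≤ 32) say `≈ 0.2·dω∕t`.  PART 2 proves `≲ (ωd∕t)·log t` for all
`d, ω, t` — the conjectured LINEAR law up to one logarithm; this PART 1 is the scheme.

THE DEVICE — TELESCOPE OVER SCALES, NOT OVER COORDINATES.  With a JACKSON LADDER `A_l = Σ_j p_{2^l}(x_j)` (`|S − A_l| ≤ dπ∕2^l`),
  `e^{iωS} = e^{iωd∕2} · e^{iω(A_0 − d∕2)} · ∏_{l=1}^{J} e^{iω(A_l − A_{l−1})} · e^{iω(S − A_J)}`: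
the `l`-th factor is the ENTIRE link `e^{iω·}` composed with a SMALL additive polynomial statistic `B_l = A_l − A_{l−1}` (`sup|B_l| ≤ R_l = 3dπ∕2^l`,
degree `2^{l+1}`), so PLAIN NESTING — the Taylor polynomial of `e^{iωs}` on `|s| ≤ R_l` of order `n_l = ⌈e²ωR_l⌉ + h`, tail `≤ e^{−h}`, planted in
`B_l` — costs total degree `≲ (e²ωR_l + h)·2^{l+1} = 6e²π·ωd + h2^{l+1}`: the oscillating part costs `≍ ωd` AT EVERY SCALE, and there are `J ≍ log₂`
scales; all factors are unimodular, so the errors ADD (complex bookkeeping; the real (cos, sin) recursion alone would lose `2^{J∕2}`).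
§0 complex bookkeeping: `norm_cexp_sub_cexp_le` (`‖e^{iα} − e^{iβ}‖ ≤ |α − β|`) · `ofReal_sum_re_add_sum_im_mul_I`
(Re∕Im assembly) · §1 coefficient sums `Σ_j C(a_j)·B^j` planted in an `MvPolynomial` `B`: `eval_coeffSum` · `totalDegree_coeffSum_le` (`≤ (n−1)·deg B`) ·
`taylorPair_eval` (the Taylor pair of `e^{iωB}`) · §2 ★ `exists_pair_mul_step` (ONE STEP: an approximant pair of `e^{iθ(x)}` times the planted Taylor
pair of `e^{iωB}` approximates `e^{i(θ+ωB)}`; degrees add `(n−1)·deg B`, errors `ε + (1+ε)e^{ωR−n}`) · §3 ★ `exists_pair_near_cexp_sum` (THE LADDER: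
`J` increments, base phase `φ₀`, error `≤ 2Σ_l e^{ωR_l − n_l}` provided this is `≤ 1`).

HONEST FRAMING (binding).  Elementary and [folklore]; ONE-SIDED (upper bounds); NO consumer in the DAG today (an optimality map of the seat's own
currency, degree model); nothing of Bałaban's instantiated; NE7 NOT PRINTED, NOT proved; N19 NOT discharged; count-neutral.  One finite `T⁴` programme
at fixed `ε`; nothing continuum ∕ `ℝ⁴` ∕ OS ∕ mass-gap ∕ Clay.  0 `def` ∕ 0 `sorry`.
-/


noncomputable section

open Finset Complex
open scoped Real

namespace Summit.QuantumFields.YangMills.Theorems.BalabanUVNodesN19SingleModeMultiscale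

open Literature.NumberTheory.Transcendental.Brownawell (norm_cexp_sub_sum_le)

variable {ι : Type*}

/-! ## §0 Complex bookkeeping [bookkeeping] -/

/-- `‖e^{iα} − e^{iβ}‖ ≤ |α − β|` (the unit circle is 1-Lipschitz in the angle). [folklore] -/
theorem norm_cexp_sub_cexp_le (α β : ℝ) : ‖exp ((α : ℂ) * I) - exp ((β : ℂ) * I)‖ ≤ |α - β| := by
  have harg : (β : ℂ) * I + I * ((α - β : ℝ) : ℂ) = (α : ℂ) * I := by push_cast; ring
  have h : exp ((α : ℂ) * I) - exp ((β : ℂ) * I) = exp ((β : ℂ) * I) * (exp (I * ((α - β : ℝ) : ℂ)) - 1) := by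
    rw [mul_sub, mul_one, ← Complex.exp_add, harg]
  rw [h, norm_mul, Complex.norm_exp_ofReal_mul_I, one_mul]
  exact (Real.norm_exp_I_mul_ofReal_sub_one_le (x := α - β)).trans_eq (Real.norm_eq_abs _)

/-- Re∕Im assembly: `Σ_j Re(c_j)b^j + (Σ_j Im(c_j)b^j)·I = Σ_j c_j b^j` for real `b`. [bookkeeping] -/
theorem ofReal_sum_re_add_sum_im_mul_I (c : ℕ → ℂ) (b : ℝ) (n : ℕ) :
    ((∑ j ∈ range n, (c j).re * b ^ j : ℝ) : ℂ) + ((∑ j ∈ range n, (c j).im * b ^ j : ℝ) : ℂ) * I =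
      ∑ j ∈ range n, c j * (b : ℂ) ^ j := by
  push_cast
  rw [Finset.sum_mul, ← Finset.sum_add_distrib]
  refine Finset.sum_congr rfl fun j _ => ?_
  calc ((c j).re : ℂ) * (b : ℂ) ^ j + ((c j).im : ℂ) * (b : ℂ) ^ j * I
      = (((c j).re : ℂ) + ((c j).im : ℂ) * I) * (b : ℂ) ^ j := by ring
    _ = c j * (b : ℂ) ^ j := by rw [Complex.re_add_im]

/-! ## §1 Coefficient sums planted in an `MvPolynomial`; the Taylor pair of `e^{iωB}` [bookkeeping] -/

/-- `Σ_j C(a_j)·B^j` evaluates to `Σ_j a_j B(x)^j`. [bookkeeping] -/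
theorem eval_coeffSum (a : ℕ → ℝ) (B : MvPolynomial ι ℝ) (n : ℕ) (x : ι → ℝ) :
    MvPolynomial.eval x (∑ j ∈ range n, MvPolynomial.C (a j) * B ^ j) =
      ∑ j ∈ range n, a j * (MvPolynomial.eval x B) ^ j := by
  rw [map_sum]
  exact Finset.sum_congr rfl fun j _ => by rw [map_mul, MvPolynomial.eval_C, map_pow]

/-- `Σ_{j<n} C(a_j)·B^j` has total degree `≤ (n − 1)·m` when `deg B ≤ m`. [bookkeeping] -/
theorem totalDegree_coeffSum_le (a : ℕ → ℝ) (B : MvPolynomial ι ℝ) (n : ℕ) {m : ℕ} (hB : B.totalDegree ≤ m) :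
    (∑ j ∈ range n, MvPolynomial.C (a j) * B ^ j).totalDegree ≤ (n - 1) * m := by
  refine MvPolynomial.totalDegree_finsetSum_le fun j hj => ?_
  have hj' : j ≤ n - 1 := by have := mem_range.1 hj; omega
  calc (MvPolynomial.C (a j) * B ^ j).totalDegree
      ≤ (MvPolynomial.C (a j) : MvPolynomial ι ℝ).totalDegree + (B ^ j).totalDegree := MvPolynomial.totalDegree_mul _ _
    _ ≤ 0 + j * B.totalDegree := by
        rw [MvPolynomial.totalDegree_C]; exact add_le_add le_rfl (MvPolynomial.totalDegree_pow _ _)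
    _ ≤ (n - 1) * m := by rw [zero_add]; exact Nat.mul_le_mul hj' hB

/-- The TAYLOR PAIR of `e^{iωb}`: with `c_j = (ωi)^j∕j!`, `Σ_j Re(c_j)b^j + (Σ_j Im(c_j)b^j)·I = Σ_{j<n} (ωb·i)^j∕j!`. [bookkeeping] -/
theorem taylorPair_eval (ω b : ℝ) (n : ℕ) :
    ((∑ j ∈ range n, (((ω : ℂ) * I) ^ j / (j.factorial : ℂ)).re * b ^ j : ℝ) : ℂ) +
        ((∑ j ∈ range n, (((ω : ℂ) * I) ^ j / (j.factorial : ℂ)).im * b ^ j : ℝ) : ℂ) * I =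
      ∑ j ∈ range n, (((ω * b : ℝ) : ℂ) * I) ^ j / (j.factorial : ℂ) := by
  rw [ofReal_sum_re_add_sum_im_mul_I]
  refine Finset.sum_congr rfl fun j _ => ?_
  push_cast
  ring

/-! ## §2 ★ One multiplicative step [folklore] -/

/-- ★ **ONE STEP OF THE TELESCOPING PRODUCT.**  Let `(Cr, Ci)` be real `MvPolynomial`s of total degree `≤ dC` with
`‖Cr(x) + Ci(x)·i − e^{iθ(x)}‖ ≤ ε` on the cube `[−1,1]^ι` (`θ` any real phase function, `ε ≥ 0`), let `B` be a real `MvPolynomial` of total degree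
`≤ m` with `|B(x)| ≤ R` on the cube, `ω ≥ 0`, and `n ≥ 1` with `e²·ωR ≤ n`.  Then the pair `(Cr·Qr − Ci·Qi, Cr·Qi + Ci·Qr)`, where `(Qr, Qi)` is the
Taylor pair of order `n` of `e^{iωB}` planted in `B`, has total degree `≤ dC + (n−1)·m` and
`‖· − e^{i(θ(x) + ωB(x))}‖ ≤ ε + (1 + ε)·e^{ωR − n}` on the cube: `zw − e^{iθ}e^{iωB} = z(w − e^{iωB}) + (z − e^{iθ})e^{iωB}` with `‖z‖ ≤ 1 + ε`,
`‖e^{iωB}‖ = 1` and the exponential Taylor tail `e^{ωR−n}`. [folklore] -/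
theorem exists_pair_mul_step {θ : (ι → ℝ) → ℝ} {Cr Ci B : MvPolynomial ι ℝ} {dC m n : ℕ} {ε R ω : ℝ}
    (hCr : Cr.totalDegree ≤ dC) (hCi : Ci.totalDegree ≤ dC) (hB : B.totalDegree ≤ m) (hε : 0 ≤ ε)
    (happ : ∀ x : ι → ℝ, (∀ i, x i ∈ Set.Icc (-1 : ℝ) 1) →
      ‖((MvPolynomial.eval x Cr : ℝ) : ℂ) + ((MvPolynomial.eval x Ci : ℝ) : ℂ) * I - exp ((θ x : ℂ) * I)‖ ≤ ε)
    (hBR : ∀ x : ι → ℝ, (∀ i, x i ∈ Set.Icc (-1 : ℝ) 1) → |MvPolynomial.eval x B| ≤ R)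
    (hω : 0 ≤ ω) (hn1 : 1 ≤ n) (hn : Real.exp 2 * (ω * R) ≤ n) :
    ∃ Cr' Ci' : MvPolynomial ι ℝ, Cr'.totalDegree ≤ dC + (n - 1) * m ∧ Ci'.totalDegree ≤ dC + (n - 1) * m ∧
      ∀ x : ι → ℝ, (∀ i, x i ∈ Set.Icc (-1 : ℝ) 1) →
        ‖((MvPolynomial.eval x Cr' : ℝ) : ℂ) + ((MvPolynomial.eval x Ci' : ℝ) : ℂ) * I -
            exp (((θ x + ω * MvPolynomial.eval x B : ℝ) : ℂ) * I)‖ ≤ ε + (1 + ε) * Real.exp (ω * R - n) := by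
  set c : ℕ → ℂ := fun j => ((ω : ℂ) * I) ^ j / (j.factorial : ℂ) with hc
  set Qr : MvPolynomial ι ℝ := ∑ j ∈ range n, MvPolynomial.C ((c j).re) * B ^ j with hQr
  set Qi : MvPolynomial ι ℝ := ∑ j ∈ range n, MvPolynomial.C ((c j).im) * B ^ j with hQi
  have hQr_deg : Qr.totalDegree ≤ (n - 1) * m := totalDegree_coeffSum_le (fun j => (c j).re) B n hB
  have hQi_deg : Qi.totalDegree ≤ (n - 1) * m := totalDegree_coeffSum_le (fun j => (c j).im) B n hB
  refine ⟨Cr * Qr - Ci * Qi, Cr * Qi + Ci * Qr, ?_, ?_, ?_⟩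
  · refine (MvPolynomial.totalDegree_sub _ _).trans (max_le ?_ ?_)
    · exact (MvPolynomial.totalDegree_mul _ _).trans (add_le_add hCr hQr_deg)
    · exact (MvPolynomial.totalDegree_mul _ _).trans (add_le_add hCi hQi_deg)
  · refine (MvPolynomial.totalDegree_add _ _).trans (max_le ?_ ?_)
    · exact (MvPolynomial.totalDegree_mul _ _).trans (add_le_add hCr hQi_deg)
    · exact (MvPolynomial.totalDegree_mul _ _).trans (add_le_add hCi hQr_deg)
  · intro x hx
    set b : ℝ := MvPolynomial.eval x B with hb
    set z : ℂ := ((MvPolynomial.eval x Cr : ℝ) : ℂ) + ((MvPolynomial.eval x Ci : ℝ) : ℂ) * I with hz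
    set w : ℂ := ((MvPolynomial.eval x Qr : ℝ) : ℂ) + ((MvPolynomial.eval x Qi : ℝ) : ℂ) * I with hw
    -- the new pair evaluates to `z * w`
    have hprod : ((MvPolynomial.eval x (Cr * Qr - Ci * Qi) : ℝ) : ℂ) +
        ((MvPolynomial.eval x (Cr * Qi + Ci * Qr) : ℝ) : ℂ) * I = z * w := by
      simp only [map_sub, map_add, map_mul, hz, hw]
      push_cast
      linear_combination (-((MvPolynomial.eval x Ci : ℝ) : ℂ) * ((MvPolynomial.eval x Qi : ℝ) : ℂ)) * Complex.I_mul_I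
    -- `w` is the Taylor polynomial of `e^{iωb}`
    have hwT : w = ∑ j ∈ range n, (((ω * b : ℝ) : ℂ) * I) ^ j / (j.factorial : ℂ) := by
      rw [hw, hQr, hQi, eval_coeffSum, eval_coeffSum]
      exact taylorPair_eval ω b n
    have hs : ‖((ω * b : ℝ) : ℂ) * I‖ ≤ ω * R := by
      rw [norm_mul, Complex.norm_real, Complex.norm_I, mul_one, Real.norm_eq_abs, abs_mul, abs_of_nonneg hω]
      exact mul_le_mul_of_nonneg_left (hBR x hx) hω
    have hwerr : ‖w - exp (((ω * b : ℝ) : ℂ) * I)‖ ≤ Real.exp (ω * R - n) := by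
      rw [norm_sub_rev, hwT]; exact norm_cexp_sub_sum_le hs hn1 hn
    have hzerr : ‖z - exp ((θ x : ℂ) * I)‖ ≤ ε := happ x hx
    have hz1 : ‖z‖ ≤ 1 + ε := by
      calc ‖z‖ = ‖exp ((θ x : ℂ) * I) + (z - exp ((θ x : ℂ) * I))‖ := by rw [add_sub_cancel]
        _ ≤ ‖exp ((θ x : ℂ) * I)‖ + ‖z - exp ((θ x : ℂ) * I)‖ := norm_add_le _ _
        _ ≤ 1 + ε := by rw [Complex.norm_exp_ofReal_mul_I]; exact add_le_add le_rfl hzerr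
    have harg : ((θ x + ω * b : ℝ) : ℂ) * I = (θ x : ℂ) * I + ((ω * b : ℝ) : ℂ) * I := by push_cast; ring
    have hexp : exp (((θ x + ω * b : ℝ) : ℂ) * I) = exp ((θ x : ℂ) * I) * exp (((ω * b : ℝ) : ℂ) * I) := by
      rw [harg, Complex.exp_add]
    rw [hprod, hexp]
    have hsplit : z * w - exp ((θ x : ℂ) * I) * exp (((ω * b : ℝ) : ℂ) * I) =
        z * (w - exp (((ω * b : ℝ) : ℂ) * I)) + (z - exp ((θ x : ℂ) * I)) * exp (((ω * b : ℝ) : ℂ) * I) := by ring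
    rw [hsplit]
    have hη0 : 0 ≤ Real.exp (ω * R - n) := (Real.exp_pos _).le
    calc ‖z * (w - exp (((ω * b : ℝ) : ℂ) * I)) + (z - exp ((θ x : ℂ) * I)) * exp (((ω * b : ℝ) : ℂ) * I)‖
        ≤ ‖z * (w - exp (((ω * b : ℝ) : ℂ) * I))‖ + ‖(z - exp ((θ x : ℂ) * I)) * exp (((ω * b : ℝ) : ℂ) * I)‖ :=
          norm_add_le _ _
      _ = ‖z‖ * ‖w - exp (((ω * b : ℝ) : ℂ) * I)‖ + ‖z - exp ((θ x : ℂ) * I)‖ * 1 := by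
          rw [norm_mul, norm_mul, Complex.norm_exp_ofReal_mul_I]
      _ ≤ (1 + ε) * Real.exp (ω * R - n) + ε * 1 :=
          add_le_add (mul_le_mul hz1 hwerr (norm_nonneg _) (by linarith)) (mul_le_mul_of_nonneg_right hzerr zero_le_one)
      _ = ε + (1 + ε) * Real.exp (ω * R - n) := by ring

/-! ## §3 ★ The ladder [folklore] -/

/-- ★ **THE TELESCOPING LADDER.**  Given increments `B_l` (real `MvPolynomial`s, total degree `≤ m_l`, `|B_l(x)| ≤ R_l` on the cube), Taylor orders
`n_l ≥ 1` with `e²ωR_l ≤ n_l`, `ω ≥ 0`, a base phase `φ₀`, and `Σ_{l<J} e^{ωR_l − n_l} ≤ ½`: there is a pair of real `MvPolynomial`s of total degree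
`≤ Σ_{l<J}(n_l − 1)m_l` with `‖Cr(x) + Ci(x)·i − e^{i(φ₀ + ωΣ_{l<J}B_l(x))}‖ ≤ 2Σ_{l<J} e^{ωR_l − n_l}` on the cube (induction on `J` with §2; the running
error stays `≤ 1`, so each step adds at most `2e^{ωR_l − n_l}`). [folklore] -/
theorem exists_pair_near_cexp_sum (φ₀ : ℝ) {ω : ℝ} (hω : 0 ≤ ω) (B : ℕ → MvPolynomial ι ℝ) (m n : ℕ → ℕ) (R : ℕ → ℝ) :
    ∀ J : ℕ, (∀ l, l < J → (B l).totalDegree ≤ m l) →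
      (∀ l, l < J → ∀ x : ι → ℝ, (∀ i, x i ∈ Set.Icc (-1 : ℝ) 1) → |MvPolynomial.eval x (B l)| ≤ R l) →
      (∀ l, l < J → 1 ≤ n l ∧ Real.exp 2 * (ω * R l) ≤ n l) →
      (∑ l ∈ range J, Real.exp (ω * R l - n l)) ≤ 1 / 2 →
      ∃ Cr Ci : MvPolynomial ι ℝ, Cr.totalDegree ≤ ∑ l ∈ range J, (n l - 1) * m l ∧
        Ci.totalDegree ≤ ∑ l ∈ range J, (n l - 1) * m l ∧
        ∀ x : ι → ℝ, (∀ i, x i ∈ Set.Icc (-1 : ℝ) 1) →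
          ‖((MvPolynomial.eval x Cr : ℝ) : ℂ) + ((MvPolynomial.eval x Ci : ℝ) : ℂ) * I -
              exp (((φ₀ + ω * ∑ l ∈ range J, MvPolynomial.eval x (B l) : ℝ) : ℂ) * I)‖ ≤
            2 * ∑ l ∈ range J, Real.exp (ω * R l - n l) := by
  intro J
  induction J with
  | zero =>
    intro _ _ _ _
    refine ⟨MvPolynomial.C (Real.cos φ₀), MvPolynomial.C (Real.sin φ₀), ?_, ?_, ?_⟩
    · rw [MvPolynomial.totalDegree_C]; exact Nat.zero_le _
    · rw [MvPolynomial.totalDegree_C]; exact Nat.zero_le _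
    · intro x _
      rw [MvPolynomial.eval_C, MvPolynomial.eval_C, sum_range_zero, sum_range_zero, mul_zero, add_zero, mul_zero]
      have h0 : ((Real.cos φ₀ : ℝ) : ℂ) + ((Real.sin φ₀ : ℝ) : ℂ) * I = exp ((φ₀ : ℂ) * I) := by
        rw [Complex.exp_mul_I, Complex.ofReal_cos, Complex.ofReal_sin]
      rw [h0, sub_self, norm_zero]
  | succ J ih =>
    intro hdeg hR hn hη
    have hηJ : 0 ≤ Real.exp (ω * R J - n J) := (Real.exp_pos _).le
    have hη' : ∑ l ∈ range J, Real.exp (ω * R l - n l) ≤ 1 / 2 := by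
      rw [Finset.sum_range_succ] at hη; linarith
    obtain ⟨Cr, Ci, hCr, hCi, happ⟩ := ih (fun l hl => hdeg l (Nat.lt_succ_of_lt hl))
      (fun l hl => hR l (Nat.lt_succ_of_lt hl)) (fun l hl => hn l (Nat.lt_succ_of_lt hl)) hη'
    have hε0 : 0 ≤ 2 * ∑ l ∈ range J, Real.exp (ω * R l - n l) :=
      mul_nonneg zero_le_two (Finset.sum_nonneg fun l _ => (Real.exp_pos _).le)
    have hε1 : 2 * ∑ l ∈ range J, Real.exp (ω * R l - n l) ≤ 1 := by linarith
    obtain ⟨Cr', Ci', hCr', hCi', happ'⟩ :=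
      exists_pair_mul_step (θ := fun x => φ₀ + ω * ∑ l ∈ range J, MvPolynomial.eval x (B l))
        hCr hCi (hdeg J (Nat.lt_succ_self J)) hε0 happ (hR J (Nat.lt_succ_self J)) hω
        (hn J (Nat.lt_succ_self J)).1 (hn J (Nat.lt_succ_self J)).2
    refine ⟨Cr', Ci', ?_, ?_, ?_⟩
    · rw [Finset.sum_range_succ]; exact hCr'
    · rw [Finset.sum_range_succ]; exact hCi'
    · intro x hx
      have hphase : φ₀ + ω * ∑ l ∈ range (J + 1), MvPolynomial.eval x (B l) =
          (φ₀ + ω * ∑ l ∈ range J, MvPolynomial.eval x (B l)) + ω * MvPolynomial.eval x (B J) := by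
        rw [Finset.sum_range_succ, mul_add, add_assoc]
      rw [hphase]
      refine (happ' x hx).trans ?_
      rw [Finset.sum_range_succ, mul_add]
      nlinarith

end Summit.QuantumFields.YangMills.Theorems.BalabanUVNodesN19SingleModeMultiscale

end
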